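import Literature.NumberTheory.NumberFields.AmbiguousClassNumberFormula
import Literature.NumberTheory.NumberFields.DihedralUnitIdentities
import HarnessLib

/-!
# Ramification in an `S₃`-extension: the primes of `K = L^τ` ramified in `L` correspond to the primes
# of `k = L^{σ,τ}` ramified in the resolvent `R = L^σ` — both are counted by the primes of `L` whose
# inertia group contains `τ`

Topic `NumberTheory/NumberFields`; namespace `Literature.NumberTheory.NumberFields.DihedralPrimes`.
THEOREM-ONLY file (no definition, no named fact, no `sorry`), written by the prover seat
`bsd-line-att-p4` g30 (cell `bsd-f1-sign2`, route `AlignedTransportAtTwo`, `--supports`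
stmt-BirchSwinnertonDyer-22298; closes nothing; BSD is proved for no curve here).  Second input (after
`DihedralUnitIdentities.lean` / `DihedralUnitCohomologyComparison.lean`) of the kernel proof of the EXACT
`2`-part of the Brauer–Kuroda relation of an `S₃`-extension (Caputo–Nuccio 2020 Prop. 3.12 / Walter):
in Chevalley's formula for the two quadratic steps `L/K` and `R/k` the ramification factors
`∏_𝔭 e_𝔭 = 2^{t}` agree.

## Setting (as in `DihedralUnitIdentities.lean`, plus the tower `k ⊆ R ⊆ L` and `Gal(L/k) = ⟨σ, τ⟩`)
`L/k` Galois with group `{σⁱ τʲ}` (`σ³ = 1`, `τ² = 1`, `τσ = σ²τ`); `R/k` Galois (group `⟨δ⟩`) inside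
`L` realising `L^σ` with `τ|_R = δ`, and `Gal(L/R) = ⟨σR⟩` with `σR` acting as `σ`; `L/K` Galois with
group `⟨τK⟩`, `τK` acting as `τ`.

## Results
* `ncard_ramified_eq_ncard_inertia` — for a QUADRATIC Galois extension `N/M` with group `⟨g⟩`:
  `#{𝔭 ⊂ 𝓞_M : e_𝔭 ≠ 1} = #{𝔓 ⊂ 𝓞_N : g ∈ I(𝔓)}` (`𝔓 ↦ 𝔓 ∩ M`; `e = #I`, `efg = 2`).
* `ncard_inertia_tau_eq` — **`#{𝔓 ⊂ 𝓞_L : τ ∈ I(𝔓)} = #{𝔮 ⊂ 𝓞_R : δ ∈ I(𝔮)}`** (`𝔓 ↦ 𝔓 ∩ R`):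
  injective because two such primes over one `𝔮` differ by `c ∈ ⟨σ⟩` with `c⁻¹τcτ = c ∈ I(𝔓)`
  (`τcτ = c⁻¹`, `c³ = 1`); surjective because `e_{L/k} = e_{R/k} · e_{L/R}` (Mathlib
  `Ideal.ramificationIdxIn_mul_ramificationIdxIn`) is even above such `𝔮`, so `I_{L/k}(𝔓)` contains an
  involution `σⁱτ = σ²ⁱ τ σ⁻²ⁱ` (Cauchy), and `τ ∈ I(σ⁻²ⁱ 𝔓)`.
* **`ncard_ramified_quadratic_step_eq`** — `#{𝔭 ⊂ 𝓞_K : e_𝔭(L/K) ≠ 1} = #{𝔩 ⊂ 𝓞_k : e_𝔩(R/k) ≠ 1}`,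
  hence (`finprod_ramificationIdxIn_quadratic_step_eq`, with the tree's
  `finprod_ramificationIdxIn_eq_pow_of_prime`) `∏_𝔭 e_𝔭(L/K) = ∏_𝔩 e_𝔩(R/k)`.

References: [CaputoNuccio2020] L. Caputo, F. A. E. Nuccio Mortarino Majno di Capriglio, Glasgow Math. J.
62 (2020), Lemma 3.9 (the types `T_s, T_r, T_i` of ramified primes in a `D_{2q}`-extension: `f_𝔩 = 1`
and `D(𝔏) = I(𝔏)` dihedral for `𝔩 ∈ T_r`), Prop. 3.10; [NeukirchANT1999] Ch. I §9 (Hilbert's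
ramification theory: `#I = e`, transitivity, conjugate primes); [Lang1990] Ch. 13 §4 Lemma 4.1.
-/

noncomputable section

open scoped NumberField Pointwise

namespace Literature.NumberTheory.NumberFields.DihedralPrimes

open NumberField IsDedekindDomain Literature.NumberTheory.NumberFields.AmbiguousClass
  Literature.NumberTheory.Automorphic Literature.NumberTheory.NumberFields.DihedralUnits

/-! ### §1 A quadratic Galois extension: ramified primes below = primes above with full inertia -/

section Quadratic

variable {M N : Type} [Field M] [NumberField M] [Field N] [NumberField N] [Algebra M N] [IsGalois M N]

/-- In a Galois extension `N/M` whose group is generated by `g ≠ 1`, `g² = 1`, the degree is `2`.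
[cite: Lang1990, Ch. 13 §4 (cyclic of prime degree)] -/
theorem finrank_eq_two {g : N ≃ₐ[M] N} (hgen : ∀ h : N ≃ₐ[M] N, h ∈ Subgroup.zpowers g)
    (hg2 : g ^ 2 = 1) (hg1 : g ≠ 1) : Module.finrank M N = 2 := by
  haveI : FiniteDimensional M N := Module.Finite.of_restrictScalars_finite ℚ M N
  rw [← IsGalois.card_aut_eq_finrank, ← orderOf_eq_card_of_forall_mem_zpowers hgen]
  exact orderOf_eq_prime hg2 hg1

/-- For a prime `𝔓` of `N` over `𝔭`: `#I(𝔓) = e_𝔭`. [cite: NeukirchANT1999, Ch. I §9 Prop. (9.6)] -/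
theorem card_inertia_eq (w : HeightOneSpectrum (𝓞 N)) :
    Nat.card (w.asIdeal.inertia (N ≃ₐ[M] N)) = (w.under (𝓞 M)).asIdeal.ramificationIdxIn (𝓞 N) := by
  haveI : w.asIdeal.LiesOver (w.under (𝓞 M)).asIdeal := ⟨rfl⟩
  haveI := (w.under (𝓞 M)).isMaximal
  haveI := w.isMaximal
  exact Ideal.card_inertia_eq_ramificationIdxIn (G := (N ≃ₐ[M] N)) (w.under (𝓞 M)).asIdeal w.asIdeal

/-- **`#{𝔭 ⊂ 𝓞_M : e_𝔭 ≠ 1} = #{𝔓 ⊂ 𝓞_N : g ∈ I(𝔓)}`** for a quadratic Galois `N/M` with group `⟨g⟩`: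
a ramified prime is totally ramified with a unique prime above it, whose inertia group is everything.
[cite: NeukirchANT1999, Ch. I §9 Prop. (9.6), Cor. (9.3)] [cite: Lang1990, Ch. 13 §4 Lemma 4.1] -/
theorem ncard_ramified_eq_ncard_inertia {g : N ≃ₐ[M] N} (hgen : ∀ h : N ≃ₐ[M] N, h ∈ Subgroup.zpowers g)
    (hg2 : g ^ 2 = 1) (hg1 : g ≠ 1) :
    {v : HeightOneSpectrum (𝓞 M) | v.asIdeal.ramificationIdxIn (𝓞 N) ≠ 1}.ncard =
      {w : HeightOneSpectrum (𝓞 N) | g ∈ w.asIdeal.inertia (N ≃ₐ[M] N)}.ncard := by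
  classical
  haveI : FiniteDimensional M N := Module.Finite.of_restrictScalars_finite ℚ M N
  have hdeg := finrank_eq_two hgen hg2 hg1
  have hcardG : Nat.card (N ≃ₐ[M] N) = 2 := by rw [IsGalois.card_aut_eq_finrank, hdeg]
  -- the inertia of a prime of `N` containing `g` has order `2 = e`
  have hram : ∀ w : HeightOneSpectrum (𝓞 N), g ∈ w.asIdeal.inertia (N ≃ₐ[M] N) →
      (w.under (𝓞 M)).asIdeal.ramificationIdxIn (𝓞 N) ≠ 1 := by
    intro w hw h1
    rw [← card_inertia_eq, Subgroup.card_eq_one] at h1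
    rw [h1] at hw
    exact hg1 (Subgroup.mem_bot.mp hw)
  symm
  refine Set.ncard_congr (fun w _ => w.under (𝓞 M)) (fun w hw => hram w hw) ?_ ?_
  · -- injective: a ramified prime of `M` has exactly one prime of `N` above it
    intro w₁ w₂ hw₁ hw₂ h12
    have he : (w₁.under (𝓞 M)).asIdeal.ramificationIdxIn (𝓞 N) = 2 :=
      ramificationIdxIn_eq_of_prime Nat.prime_two hdeg (hram w₁ hw₁)
    haveI := (w₁.under (𝓞 M)).isMaximal
    have hfund := Ideal.ncard_primesOver_mul_ramificationIdxIn_mul_inertiaDegIn (w₁.under (𝓞 M)).asIdeal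
      (𝓞 N) (N ≃ₐ[M] N)
    rw [hcardG, he] at hfund
    have hone : ((w₁.under (𝓞 M)).asIdeal.primesOver (𝓞 N)).ncard = 1 := by
      have hf : (w₁.under (𝓞 M)).asIdeal.inertiaDegIn (𝓞 N) ≠ 0 :=
        Ideal.inertiaDegIn_ne_zero (N ≃ₐ[M] N)
      have h1 : 1 ≤ ((w₁.under (𝓞 M)).asIdeal.primesOver (𝓞 N)).ncard :=
        IsDedekindDomain.one_le_primesOver_ncard _ _
      nlinarith [Nat.one_le_iff_ne_zero.mpr hf]
    obtain ⟨P, hP⟩ := Set.ncard_eq_one.mp hone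
    have hm₁ : w₁.asIdeal ∈ (w₁.under (𝓞 M)).asIdeal.primesOver (𝓞 N) := ⟨w₁.isPrime, ⟨rfl⟩⟩
    have hm₂ : w₂.asIdeal ∈ (w₁.under (𝓞 M)).asIdeal.primesOver (𝓞 N) :=
      ⟨w₂.isPrime, ⟨by rw [← HeightOneSpectrum.under_asIdeal, ← h12]⟩⟩
    rw [hP, Set.mem_singleton_iff] at hm₁ hm₂
    exact HeightOneSpectrum.ext (hm₁.trans hm₂.symm)
  · -- surjective: above a ramified prime, the inertia group is all of `Gal(N/M)`
    intro v hv
    haveI := v.isMaximal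
    obtain ⟨Q, hQ, hQv⟩ := Ideal.exists_maximal_ideal_liesOver_of_isIntegral (S := 𝓞 N) v.asIdeal
    let w : HeightOneSpectrum (𝓞 N) := ⟨Q, hQ.isPrime, Ideal.ne_bot_of_liesOver_of_ne_bot v.ne_bot Q⟩
    have hwv : w.under (𝓞 M) = v := HeightOneSpectrum.ext hQv.over.symm
    refine ⟨w, ?_, hwv⟩
    have he : v.asIdeal.ramificationIdxIn (𝓞 N) = 2 := ramificationIdxIn_eq_of_prime Nat.prime_two hdeg hv
    have htop : w.asIdeal.inertia (N ≃ₐ[M] N) = ⊤ := by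
      apply Subgroup.eq_top_of_card_eq
      rw [card_inertia_eq, hwv, he, hcardG]
    simp only [Set.mem_setOf_eq, htop, Subgroup.mem_top]

end Quadratic


/-! ### §2 Inertia bookkeeping: conjugation, pull-back to `R`, dihedral relations -/

section Inertia

variable {G B : Type*} [Group G] [CommRing B] [MulSemiringAction G B]

/-- `h ∈ I(c • 𝔓) ↔ c⁻¹ h c ∈ I(𝔓)` (inertia groups of conjugate primes are conjugate).
[cite: NeukirchANT1999, Ch. I §9 (9.4) (conjugate primes, `G_{σ𝔓} = σ G_𝔓 σ⁻¹`)] -/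
theorem mem_inertia_smul_iff (c h : G) (P : Ideal B) :
    h ∈ (c • P).inertia G ↔ c⁻¹ * h * c ∈ P.inertia G := by
  simp only [Ideal.inertia, AddSubgroup.mem_inertia, Submodule.mem_toAddSubgroup,
    Ideal.mem_pointwise_smul_iff_inv_smul_mem, smul_sub, mul_smul]
  constructor
  · intro H y
    simpa only [inv_smul_smul] using H (c • y)
  · intro H x
    simpa only [smul_inv_smul] using H (c⁻¹ • x)

end Inertia

section SymmetricThree

variable {k R L : Type} [Field k] [NumberField k] [Field R] [NumberField R] [Field L] [NumberField L]
  [Algebra k R] [Algebra k L] [Algebra R L] [IsScalarTower k R L]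
  {σ τ : L ≃ₐ[k] L} {δ : R ≃ₐ[k] R}

omit [NumberField k] [NumberField R] [NumberField L] in
/-- `τ σⁿ = σ²ⁿ τ`. [cite: CaputoNuccio2020, §2 (`σρ = ρ⁻¹σ`)] -/
theorem tau_mul_sigma_pow (hτσ : τ * σ = σ ^ 2 * τ) (n : ℕ) : τ * σ ^ n = σ ^ (2 * n) * τ := by
  induction n with
  | zero => simp
  | succ n ih =>
    rw [pow_succ, ← mul_assoc, ih, mul_assoc, hτσ, ← mul_assoc, ← pow_add, Nat.mul_succ]

omit [NumberField k] [NumberField R] [NumberField L] [IsScalarTower k R L] in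
/-- On the ring of integers, `algebraMap (δ y) = τ (algebraMap y)`. [cite: CaputoNuccio2020, §3 (`Δ = Gal(F/k)`)] -/
theorem algebraMap_delta_smul (hδ : ∀ y : R, algebraMap R L (δ y) = τ (algebraMap R L y))
    (y : 𝓞 R) : algebraMap (𝓞 R) (𝓞 L) (δ • y) = τ • algebraMap (𝓞 R) (𝓞 L) y :=
  NumberField.RingOfIntegers.ext (hδ y)

omit [NumberField k] [NumberField R] [NumberField L] [IsScalarTower k R L] in
/-- If `τ ∈ I(𝔓)` then `δ ∈ I(𝔓 ∩ R)`. [cite: NeukirchANT1999, Ch. I §9 (9.4)] -/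
theorem delta_mem_inertia_under (hδ : ∀ y : R, algebraMap R L (δ y) = τ (algebraMap R L y))
    {w : HeightOneSpectrum (𝓞 L)} (hw : τ ∈ w.asIdeal.inertia (L ≃ₐ[k] L)) :
    δ ∈ (w.under (𝓞 R)).asIdeal.inertia (R ≃ₐ[k] R) := by
  intro y
  rw [HeightOneSpectrum.under_asIdeal, Submodule.mem_toAddSubgroup, Ideal.under_def, Ideal.mem_comap,
    map_sub, algebraMap_delta_smul hδ]
  exact hw _

omit [NumberField R] [Algebra k R] [IsScalarTower k R L] in
/-- An automorphism fixing `R = L^σ` pointwise is a power of `σ` (Galois correspondence).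
[cite: Lang1990, Ch. 13 §4 (Galois descent)] -/
theorem mem_zpowers_of_forall_apply_algebraMap (hR : ∀ x : L, σ x = x ↔ x ∈ Set.range (algebraMap R L))
    {c : L ≃ₐ[k] L} (hc : ∀ y : R, c (algebraMap R L y) = algebraMap R L y) : c ∈ Subgroup.zpowers σ := by
  haveI : FiniteDimensional k L := Module.Finite.of_restrictScalars_finite ℚ k L
  rw [← IntermediateField.fixingSubgroup_fixedField (Subgroup.zpowers σ), IntermediateField.mem_fixingSubgroup_iff]
  intro x hx
  have hσx : σ x = x := (IntermediateField.mem_fixedField_iff _ x).mp hx σ (Subgroup.mem_zpowers σ)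
  obtain ⟨y, rfl⟩ := (hR x).mp hσx
  exact hc y

omit [NumberField k] [NumberField R] [NumberField L] [Algebra k R] [IsScalarTower k R L] [Algebra R L] in
/-- Dihedral relations for a power `c` of `σ`: `τ c τ = c⁻¹` and `c³ = 1`.
[cite: CaputoNuccio2020, §2 (`σρ = ρ⁻¹σ`, `ρ^q = 1`)] -/
theorem tau_mul_mul_tau_of_mem_zpowers (hσ : σ ^ 3 = 1) (hτ : τ ^ 2 = 1) (hτσ : τ * σ = σ ^ 2 * τ)
    {c : L ≃ₐ[k] L} (hc : c ∈ Subgroup.zpowers σ) : τ * c * τ = c⁻¹ ∧ c ^ 3 = 1 := by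
  obtain ⟨n, rfl⟩ := Subgroup.mem_zpowers_iff.mp hc
  have hτinv : τ⁻¹ = τ := by
    rw [inv_eq_iff_mul_eq_one, ← pow_two, hτ]
  have hconj : τ * σ * τ⁻¹ = σ⁻¹ := by
    rw [hτσ, mul_assoc, mul_inv_cancel, mul_one]
    exact eq_inv_of_mul_eq_one_left (by rw [← pow_succ, hσ])
  refine ⟨?_, ?_⟩
  · nth_rewrite 2 [← hτinv]
    calc τ * σ ^ n * τ⁻¹ = (MulAut.conj τ) (σ ^ n) := rfl
      _ = ((MulAut.conj τ) σ) ^ n := map_zpow _ _ _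
      _ = (τ * σ * τ⁻¹) ^ n := rfl
      _ = (σ ^ n)⁻¹ := by rw [hconj, inv_zpow]
  · rw [← zpow_natCast, ← zpow_mul, mul_comm, zpow_mul, zpow_natCast, hσ, one_zpow]

omit [NumberField k] [NumberField R] [NumberField L] [Algebra k R] [IsScalarTower k R L] [Algebra R L] in
/-- **Injectivity**: if `τ ∈ I(𝔓)` and `τ ∈ I(c • 𝔓)` for a power `c` of `σ`, then `c • 𝔓 = 𝔓`
(`c⁻¹τcτ = c ∈ I(𝔓)`). [cite: CaputoNuccio2020, Lemma 3.9 (`D(𝔏) = I(𝔏)` dihedral for `𝔩 ∈ T_r`)] -/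
theorem smul_eq_of_tau_mem_inertia (hσ : σ ^ 3 = 1) (hτ : τ ^ 2 = 1) (hτσ : τ * σ = σ ^ 2 * τ)
    {c : L ≃ₐ[k] L} (hc : c ∈ Subgroup.zpowers σ) {P : Ideal (𝓞 L)}
    (h1 : τ ∈ P.inertia (L ≃ₐ[k] L)) (h2 : τ ∈ (c • P).inertia (L ≃ₐ[k] L)) : c • P = P := by
  obtain ⟨hconj, hc3⟩ := tau_mul_mul_tau_of_mem_zpowers hσ hτ hτσ hc
  rw [mem_inertia_smul_iff] at h2
  have h3 : c⁻¹ * τ * c * τ ∈ P.inertia (L ≃ₐ[k] L) := Subgroup.mul_mem _ h2 h1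
  have hc' : c⁻¹ * τ * c * τ = c := by
    calc c⁻¹ * τ * c * τ = c⁻¹ * (τ * c * τ) := by group
      _ = c⁻¹ * c⁻¹ * c ^ 3 := by rw [hconj, hc3, mul_one]
      _ = c := by group
  rw [hc'] at h3
  exact Ideal.inertia_le_stabilizer P h3

end SymmetricThree

/-! ### §3 The correspondence `{𝔓 ⊂ 𝓞_L : τ ∈ I(𝔓)} ↔ {𝔮 ⊂ 𝓞_R : δ ∈ I(𝔮)}` and the count -/

section Count

variable {k R L : Type} [Field k] [NumberField k] [Field R] [NumberField R] [Field L] [NumberField L]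
  [Algebra k R] [Algebra k L] [Algebra R L] [IsScalarTower k R L] [IsGalois k L] [IsGalois k R]
  {σ τ : L ≃ₐ[k] L} {δ : R ≃ₐ[k] R}

omit [NumberField k] [NumberField R] [NumberField L] [IsScalarTower k R L] [IsGalois k L] [IsGalois k R]
  [Algebra k R] in
/-- Powers of `σ` fix `R`. [cite: CaputoNuccio2020, §3 (`F = L^G`)] -/
theorem sigma_pow_apply_algebraMap (hR : ∀ x : L, σ x = x ↔ x ∈ Set.range (algebraMap R L)) (n : ℕ)
    (y : R) : (σ ^ n) (algebraMap R L y) = algebraMap R L y := by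
  induction n with
  | zero => simp
  | succ n ih => rw [pow_succ, AlgEquiv.mul_apply, (hR _).mpr ⟨y, rfl⟩, ih]

/-- **`#{𝔓 ⊂ 𝓞_L : τ ∈ I(𝔓)} = #{𝔮 ⊂ 𝓞_R : δ ∈ I(𝔮)}`** via `𝔓 ↦ 𝔓 ∩ R`, for an `S₃`-extension `L/k`
(`Gal(L/k) = {σⁱτʲ}`, `R = L^σ`, `τ|_R = δ`): injective since two such `𝔓` over one `𝔮` are
`⟨σ⟩`-conjugate and `c⁻¹τcτ = c`; surjective since `e_{L/k} = e_{R/k}·e_{L/R} = 2·e_{L/R}` above such `𝔮`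
gives an involution `σⁱτ = σ²ⁱ τ σ⁻²ⁱ` in `I_{L/k}(𝔓)` (Cauchy).
[cite: CaputoNuccio2020, Lemma 3.9, Prop. 3.10] [cite: NeukirchANT1999, Ch. I §9 Prop. (9.6), (9.4)] -/
theorem ncard_inertia_tau_eq (hσ : σ ^ 3 = 1) (hτ : τ ^ 2 = 1) (hτσ : τ * σ = σ ^ 2 * τ)
    (hgen : ∀ g : L ≃ₐ[k] L, ∃ i j : ℕ, j < 2 ∧ g = σ ^ i * τ ^ j)
    (hR : ∀ x : L, σ x = x ↔ x ∈ Set.range (algebraMap R L))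
    (hδ : ∀ y : R, algebraMap R L (δ y) = τ (algebraMap R L y))
    (hgenk : ∀ g : R ≃ₐ[k] R, g ∈ Subgroup.zpowers δ) (hδ1 : δ ≠ 1) :
    {w : HeightOneSpectrum (𝓞 L) | τ ∈ w.asIdeal.inertia (L ≃ₐ[k] L)}.ncard =
      {u : HeightOneSpectrum (𝓞 R) | δ ∈ u.asIdeal.inertia (R ≃ₐ[k] R)}.ncard := by
  classical
  haveI : IsGalois R L := IsGalois.tower_top_of_isGalois k R L
  refine Set.ncard_congr (fun w _ => w.under (𝓞 R)) (fun w hw => delta_mem_inertia_under hδ hw) ?_ ?_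
  · -- injective
    intro w₁ w₂ hw₁ hw₂ h12
    haveI : w₁.asIdeal.LiesOver (w₁.under (𝓞 R)).asIdeal := ⟨rfl⟩
    haveI : w₂.asIdeal.LiesOver (w₁.under (𝓞 R)).asIdeal :=
      ⟨by rw [← HeightOneSpectrum.under_asIdeal, ← h12]⟩
    obtain ⟨g, hg⟩ := Ideal.exists_smul_eq_of_isGaloisGroup (w₁.under (𝓞 R)).asIdeal w₁.asIdeal
      w₂.asIdeal (L ≃ₐ[R] L)
    set c : L ≃ₐ[k] L := AlgEquiv.restrictScalars k g with hc_def
    have hcg : (c • w₁.asIdeal : Ideal (𝓞 L)) = g • w₁.asIdeal := by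
      rw [Ideal.pointwise_smul_def, Ideal.pointwise_smul_def]
      rfl
    have hc : c ∈ Subgroup.zpowers σ :=
      mem_zpowers_of_forall_apply_algebraMap hR fun y => g.commutes y
    have h2 : τ ∈ (c • w₁.asIdeal).inertia (L ≃ₐ[k] L) := by rw [hcg, hg]; exact hw₂
    apply HeightOneSpectrum.ext
    rw [← hg, ← hcg, smul_eq_of_tau_mem_inertia hσ hτ hτσ hc hw₁ h2]
  · -- surjective
    intro u hu
    haveI := u.isMaximal
    haveI : u.asIdeal.LiesOver (u.under (𝓞 k)).asIdeal := ⟨rfl⟩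
    haveI := (u.under (𝓞 k)).isMaximal
    -- `e_{R/k} = 2` below `u`
    have hIu : u.asIdeal.inertia (R ≃ₐ[k] R) = ⊤ := by
      rw [eq_top_iff]
      intro g _
      rcases eq_one_or_eq_of_generator hgenk (delta_sq hτ hδ) g with rfl | rfl
      · exact Subgroup.one_mem _
      · exact hu
    have heRk : (u.under (𝓞 k)).asIdeal.ramificationIdxIn (𝓞 R) = 2 := by
      rw [← card_inertia_eq u, hIu, Subgroup.card_top]
      exact card_eq_two_of_generator hgenk (delta_sq hτ hδ) hδ1
    -- a prime `Q` of `L` above `u`; `e_{L/k} = 2 · e_{L/R}` there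
    obtain ⟨Q, hQ, hQu⟩ := Ideal.exists_maximal_ideal_liesOver_of_isIntegral (S := 𝓞 L) u.asIdeal
    haveI := hQu
    haveI : Q.LiesOver (u.under (𝓞 k)).asIdeal := Ideal.LiesOver.trans Q u.asIdeal (u.under (𝓞 k)).asIdeal
    haveI : Nonempty (u.asIdeal.primesOver (𝓞 L)) := ⟨⟨Q, hQ.isPrime, hQu⟩⟩
    have hmul := Ideal.ramificationIdxIn_mul_ramificationIdxIn (p := (u.under (𝓞 k)).asIdeal)
      (P := u.asIdeal) (G := R ≃ₐ[k] R) (C := 𝓞 L) (GAC := L ≃ₐ[k] L) (GBC := L ≃ₐ[R] L)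
    have hIW : Nat.card (Q.inertia (L ≃ₐ[k] L)) = (u.under (𝓞 k)).asIdeal.ramificationIdxIn (𝓞 L) :=
      Ideal.card_inertia_eq_ramificationIdxIn (G := (L ≃ₐ[k] L)) (u.under (𝓞 k)).asIdeal Q
    have h2 : 2 ∣ Nat.card (Q.inertia (L ≃ₐ[k] L)) := by
      rw [hIW, ← hmul, heRk]
      exact dvd_mul_right 2 _
    -- Cauchy: an involution `σⁱ τ` in `I(Q)`
    haveI : Fact (Nat.Prime 2) := ⟨Nat.prime_two⟩
    letI : Fintype (Q.inertia (L ≃ₐ[k] L)) := Fintype.ofFinite _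
    obtain ⟨g, hg⟩ := exists_prime_orderOf_dvd_card (G := Q.inertia (L ≃ₐ[k] L)) 2
      (by rwa [← Nat.card_eq_fintype_card])
    have hg2 : orderOf (g : L ≃ₐ[k] L) = 2 := by rw [Subgroup.orderOf_coe, hg]
    obtain ⟨i, j, hj, hgij⟩ := hgen g
    have hj1 : j = 1 := by
      interval_cases j
      · exfalso
        have h3 : (g : L ≃ₐ[k] L) ^ 3 = 1 := by
          rw [hgij, pow_zero, mul_one, ← pow_mul, mul_comm, pow_mul, hσ, one_pow]
        have h := orderOf_dvd_of_pow_eq_one h3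
        rw [hg2] at h
        norm_num at h
      · rfl
    subst hj1
    rw [pow_one] at hgij
    -- `g = c τ c⁻¹` with `c = σ²ⁱ`, so `τ ∈ I(c⁻¹ Q)`
    set c : L ≃ₐ[k] L := σ ^ (2 * i) with hc_def
    have hcτ : (g : L ≃ₐ[k] L) * c = c * τ := by
      rw [hgij, hc_def, mul_assoc, tau_mul_sigma_pow hτσ, ← mul_assoc, ← pow_add,
        show i + 2 * (2 * i) = 3 * i + 2 * i by ring, pow_add, pow_mul σ 3 i, hσ, one_pow, one_mul]
    have hτI : τ ∈ (c⁻¹ • Q).inertia (L ≃ₐ[k] L) := by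
      rw [mem_inertia_smul_iff, inv_inv, ← hcτ, mul_inv_cancel_right]
      exact g.2
    let W : HeightOneSpectrum (𝓞 L) := ⟨Q, hQ.isPrime, Ideal.ne_bot_of_liesOver_of_ne_bot u.ne_bot Q⟩
    refine ⟨c⁻¹ • W, hτI, HeightOneSpectrum.ext ?_⟩
    rw [HeightOneSpectrum.under_asIdeal, HeightOneSpectrum.smul_asIdeal, hQu.over]
    ext y
    rw [Ideal.under_def, Ideal.mem_comap, Ideal.mem_inv_pointwise_smul_iff, Ideal.under_def, Ideal.mem_comap]
    have hcy : c • algebraMap (𝓞 R) (𝓞 L) y = algebraMap (𝓞 R) (𝓞 L) y :=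
      NumberField.RingOfIntegers.ext (sigma_pow_apply_algebraMap hR (2 * i) y)
    rw [hcy]

/-- **`#{𝔭 ⊂ 𝓞_K : e_𝔭(L/K) ≠ 1} = #{𝔩 ⊂ 𝓞_k : e_𝔩(R/k) ≠ 1}`**: in an `S₃`-extension the primes of the
fixed field `K` of `τ` ramified in the quadratic step `L/K` correspond bijectively to the primes of `k`
ramified in the resolvent step `R/k` (both ↔ primes of `L` with `τ` in the inertia group).
[cite: CaputoNuccio2020, Lemma 3.9, Prop. 3.10] [cite: NeukirchANT1999, Ch. I §9 Prop. (9.6)] -/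
theorem ncard_ramified_quadratic_step_eq {K : Type} [Field K] [NumberField K] [Algebra K L] [IsGalois K L]
    {τK : L ≃ₐ[K] L} (hσ : σ ^ 3 = 1) (hτ : τ ^ 2 = 1) (hτσ : τ * σ = σ ^ 2 * τ) (hτ1 : τ ≠ 1)
    (hgen : ∀ g : L ≃ₐ[k] L, ∃ i j : ℕ, j < 2 ∧ g = σ ^ i * τ ^ j)
    (hτK : ∀ x : L, τK x = τ x) (hgenK : ∀ g : L ≃ₐ[K] L, g ∈ Subgroup.zpowers τK)
    (hR : ∀ x : L, σ x = x ↔ x ∈ Set.range (algebraMap R L))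
    (hδ : ∀ y : R, algebraMap R L (δ y) = τ (algebraMap R L y))
    (hgenk : ∀ g : R ≃ₐ[k] R, g ∈ Subgroup.zpowers δ) (hδ1 : δ ≠ 1) :
    {v : HeightOneSpectrum (𝓞 K) | v.asIdeal.ramificationIdxIn (𝓞 L) ≠ 1}.ncard =
      {v : HeightOneSpectrum (𝓞 k) | v.asIdeal.ramificationIdxIn (𝓞 R) ≠ 1}.ncard := by
  rw [ncard_ramified_eq_ncard_inertia hgenK (tauK_sq hτ hτK) (tauK_ne_one hτ1 hτK),
    ncard_ramified_eq_ncard_inertia hgenk (delta_sq hτ hδ) hδ1,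
    ← ncard_inertia_tau_eq hσ hτ hτσ hgen hR hδ hgenk hδ1]
  congr 1
  ext w
  simp only [Set.mem_setOf_eq, Ideal.inertia, AddSubgroup.mem_inertia, Submodule.mem_toAddSubgroup]
  have hx : ∀ x : 𝓞 L, τK • x = τ • x := fun x => NumberField.RingOfIntegers.ext (hτK x)
  simp only [hx]

/-- **`∏_𝔭 e_𝔭(L/K) = ∏_𝔩 e_𝔩(R/k)`**: the ramification factors of Chevalley's ambiguous class number
formula agree for the quadratic step and the resolvent step of an `S₃`-extension.
[cite: CaputoNuccio2020, Prop. 3.10] [cite: Lang1990, Ch. 13 §4 Lemma 4.1] -/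
theorem finprod_ramificationIdxIn_quadratic_step_eq {K : Type} [Field K] [NumberField K] [Algebra K L]
    [IsGalois K L] {τK : L ≃ₐ[K] L} (hσ : σ ^ 3 = 1) (hτ : τ ^ 2 = 1) (hτσ : τ * σ = σ ^ 2 * τ)
    (hτ1 : τ ≠ 1) (hgen : ∀ g : L ≃ₐ[k] L, ∃ i j : ℕ, j < 2 ∧ g = σ ^ i * τ ^ j)
    (hτK : ∀ x : L, τK x = τ x) (hgenK : ∀ g : L ≃ₐ[K] L, g ∈ Subgroup.zpowers τK)
    (hR : ∀ x : L, σ x = x ↔ x ∈ Set.range (algebraMap R L))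
    (hδ : ∀ y : R, algebraMap R L (δ y) = τ (algebraMap R L y))
    (hgenk : ∀ g : R ≃ₐ[k] R, g ∈ Subgroup.zpowers δ) (hδ1 : δ ≠ 1) :
    (∏ᶠ v : HeightOneSpectrum (𝓞 K), v.asIdeal.ramificationIdxIn (𝓞 L)) =
      ∏ᶠ v : HeightOneSpectrum (𝓞 k), v.asIdeal.ramificationIdxIn (𝓞 R) := by
  rw [finprod_ramificationIdxIn_eq_pow_of_prime Nat.prime_two
      (finrank_eq_two hgenK (tauK_sq hτ hτK) (tauK_ne_one hτ1 hτK)),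
    finprod_ramificationIdxIn_eq_pow_of_prime Nat.prime_two (finrank_eq_two hgenk (delta_sq hτ hδ) hδ1),
    ncard_ramified_quadratic_step_eq hσ hτ hτσ hτ1 hgen hτK hgenK hR hδ hgenk hδ1]

end Count

end Literature.NumberTheory.NumberFields.DihedralPrimes
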